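import Summits.BirchSwinnertonDyer.Rank1Residual.ManinAdditive.KatoCurvePlusDefect
import Summits.BirchSwinnertonDyer.BirchSwinnertonDyer.Theorems.ManinLocalTwoThreeShimuraRationalThreeIsogeny
import Literature.NumberTheory.EllipticCurves.ShimuraSubgroupHeckeCongruence
import Literature.NumberTheory.EllipticCurves.ManinConstantGamma1ModularDegree
import Literature.NumberTheory.EllipticCurves.CuspFormLFunctionLevelConductorProofs
import Literature.NumberTheory.EllipticCurves.NewformsHeckeProofs
import HarnessLib
import HarnessLib.Audit.Tags

/-!
# The PLUS INDEX `[Λ_f⁺ : Λ₁(f)⁺]` and the typed shadows of the homological generation law GEN⋆: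
# E-es-66 / 66₂ / 67 / 67♮ / 67♯, their compositions, the HECKE SIEVE and the Γ₀/Γ₁-trichotomy edges — BY NAME
# (cell `bsd-f2-manin`, Euler-system lens `bsd-f2-manin-es` g18, MEMO-es §31.10–31.16; typing ask T-es-22, typer g13)

HONEST FRAMING.  LENS = Euler systems / Kato's explicit reciprocity read on the Shimura cover `E₁ → E₀`
(`Λ₁(f) = periodLatticeGamma1 f ⊆ Λ_f = periodLattice f`).  SOURCE = HOME/es/Sketch-es-g18.lean ef55fface19232db §4a–§4d
(l. 1337–1544; = 09a57c41c3234851 §4 unchanged; farm rc 0 · 0 sorries · axioms standard; es BC7 g18-bc7b fd2380a0a552bddb / g18-bc7c 27fe4f7af75d7a66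
5/5 CLEAN), typed VERBATIM over the TREE vocabulary: the sketch's private `ThreeAdicPolarWitness` / `TwoAdicPolarWitness`
/ `ThreeAdicUnitWitnessOfNoRationalThreeTorsion` (E-es-61) ARE the landed `…ManinAdditive.KatoCurve` declarations
(bodies textually identical, checked by the typer), `IsShortThreeTorsion` / `shortModel` are `…ManinAdditive.CuspidalKummer`'s.
Omitted from §4: the net edge `res3Flat_of_inputs_of_real'` (its `Res3FlatReal` is es's v10 cut §3c, not in the tree —
lands with T-es-21′ if the C3 LEAD adopts the cut).

WHAT IS TYPED.  `PlusIndexPrimeTo p f` (every `x + x̄`, `x ∈ Λ_f`, becomes a `Γ₁`-plus-period after a prime-to-`p`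
integer multiple — the plus index `d = [Λ_f⁺ : Λ₁(f)⁺]` is prime to `p`); `HasShortMuThree W c` (`μ₃ ⊆ E_{W,c}[3]`).
LAWS (`@[conjecture]`, nothing asserted): **E-es-66 `ThreeAdicWitnessOfPlusIndexPrimeToThree`** (optimal `W`, `9 ∣ N`,
`3 ∤ d` ⟹ a 3-adic even polar UNIT witness against `Ω(W)` — THE CHARTER CANDIDATE of the lens: «the twisted-sum side
sees NO local invariant at p — only d, decided by `W ∩ Σ(N)`», MEMO-es §31.14), its `p = 2` twin **E-es-66₂
`TwoAdicWitnessOfPlusIndexOdd`**, the index law **E-es-67 `PlusIndexPrimeToThreeOfNoRationalThreeTorsion`** and its two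
halves **E-es-67♮ `PlusIndexPrimeToThreeOfNoMuThree`** (theorem on paper mod the Shimura-subgroup dictionary) and
**E-es-67♯ `PlusIndexPrimeToThreeOfMuThreeNoRationalThreeTorsion`** (empirical).  PROVED (es, kernel-checked; copied
verbatim): E-67 ⟸ 67♮ ∧ 67♯; **E-es-61 = E-es-66 ∘ E-es-67** (`threeAdicUnitWitnessOfNoRationalThreeTorsion_of_plusIndex`
— TURNKEY-es-9: C3 v10 may take `h61 := … h66 h67`); `plusIndexPrimeTo_of_eq`; the HECKE SIEVE §4c from the tree's
THEOREM W `heckeEigenPeriodCongruence_holds` and `pMulLatticeLeGamma1OfTracelessPrime_holds` (`PlusIndexPrimeTo p D.f`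
BY NAME whenever some prime `q ∣ N`, `q ≠ p`, has `q² ∣ N` or `p ∤ a_q − q`: E-es-66's hypothesis is a THEOREM on 8 897
of the 10 082 optimal classes `9 ∣ N < 10⁴`, E42d 0e1317d0789e5b5d); §4d the BY-NAME edges from p3's 3-adic Γ₀/Γ₁
trichotomy (`…Theorems.ManinLocalTwoThree.trichotomy_shimura_of_nine_dvd_level`,
`stevens_eq_optimal_of_noRationalThreeIsogeny_nine_mul_prime`; that Theorems file imports only Literature + the leaf
`ShimuraLedger`, so this module stays outside the theses cone).
BC5 WITNESS (es tables of record): E42 v2 GEN⋆ EXACT at 177/177 `(p, N)` (all 86 levels `4 ∣ N ≤ 360`, all 38 levels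
`9 ∣ N ≤ 360` + 450 + 576, 51 controls; `[S : L′] = |G/I| = #Σ`-cover group every time; HOME/es/E42-GENSTAR-SUMMARY-v2.txt
1fe6fe04cc14c713, engine e41-src/g18_gen.py f971e70edfc1040f; second engine D-es-19 REQUESTED); E42b/E42c: `A₃ = 0` for
every `9 ∣ N < 10⁴` class except 27a, 54a; `A₂ = 1` on exactly 24 classes `4 ∣ N < 10⁴` (all `W[2]`-reducible).
REFUTER VERDICTS: REF1 §R67 (R-es-36/37, refuter-bsd-f2-manin-ref1 g10 2026-08-28T14:45Z, HOME/ref1/R67-ref1-es-g18.md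
3182991c71e18394): E-es-66/66₂ SURVIVE (LAW; GEN⋆ two-engine — PARI msinit replicates E42 v2 177/177), E-es-67/67♯ SURVIVE (LAW),
E-es-67♮ THEOREM-candidate (Vatsal Rem. 1.8 + Ling–Oesterlé dictionary), THM R VALID, BC7 summit-mode 11/11 CLEAN, 0 killed; REF2 placement: generation statement NOT in the held literature
(nearest Ash–Stevens 1986, Stevens 1985 TAMS — acq-11413/11414 open; Kim–Sun acq-13981; Lee–Sun 2019 §3).
bears_on: stmt-BirchSwinnertonDyer-22968 (C3 `ManinPrimeToThreeAtNine`, stub 5 / v10 input h61) and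
stmt-BirchSwinnertonDyer-22967 (C2, the 24-class list).  PARTITION 0 · beyond-print theorem: no (laws + bookkeeping
over tree theorems) · BSD is not proved by this; Manin's conjecture is not proved by this.
[cite: Vatsal2005, Rem. 1.8 (shape: the Shimura cover and `W ∩ Σ(N)`; the laws are the cell's rows E-es-66/67, NOT in print)]
[cite: LingOesterle1991, Thm. «T_p = p on Σ(N)» (the sieve's printed input, tree THEOREM W)]
-/

set_option autoImplicit false

noncomputable section

open scoped Classical MatrixGroups ModularForm ComplexConjugate

open CongruenceSubgroup Complex WeierstrassCurve Literature.NumberTheory.EllipticCurves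
  Literature.NumberTheory.EllipticCurves.ModularForms

namespace Summit.BirchSwinnertonDyer.Rank1Residual.ManinAdditive.KatoCurve

open Summit.BirchSwinnertonDyer.Rank1Residual.ManinAdditive.CuspidalKummer
  Summit.BirchSwinnertonDyer.Rank1Residual.ManinAdditive.CuspidalKummerThree

/-! ### §4a. The plus index and the five laws (es Sketch-es-g18 §4 VERBATIM; `@[conjecture]` = nothing asserted) -/

/-- The plus part of `Λ₁(f) = periodLatticeGamma1 f` has index prime to `p` in the plus part of `Λ_f`:
every `x + x̄`, `x ∈ Λ_f`, becomes a `Γ₁`-plus-period after multiplication by an integer prime to `p`. -/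
def PlusIndexPrimeTo (p : ℕ) {N : ℕ} (f : CuspForm (Gamma0 N) 2) : Prop :=
  ∀ x ∈ periodLattice f, ∃ y ∈ periodLatticeGamma1 f, ∃ k : ℕ, ¬ p ∣ k ∧
    (k : ℂ) * (x + starRingEnd ℂ x) = y + starRingEnd ℂ y

/-- **E-es-66** (g18 LAW, the f-shadow of GEN⋆₃): if the plus index `[Λ_f⁺ : Λ₁(f)⁺]` is prime to `3`, a
`3`-adic even polar UNIT witness against `Ω(W)` exists for the optimal curve `W` with `9 ∣ N`.
Evidence: E42 (GEN⋆₃ exact at 30 levels 9 ∣ N) + E38 (gA = κ1, 56/56).  Beyond print (the generation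
statement is not in the held literature; nearest: Ash–Stevens 1986, Kim–Sun (preprint), Lee–Sun 2019 §3).
Cell bsd-f2-manin row **E-es-66** — LAW (the CHARTER CANDIDATE of the es lens at 3; f-shadow of GEN⋆₃). BC5: E42 v2 GEN⋆ EXACT 177/177 (p,N) incl. all 38 levels `9 ∣ N ≤ 360` + 450 + 576 (HOME/es/E42-GENSTAR-SUMMARY-v2.txt 1fe6fe04cc14c713); E38 56/56; by the HECKE SIEVE below its hypothesis is a theorem BY NAME on 8 897 of the 10 082 optimal classes `9 ∣ N < 10⁴`. NOT in print (nearest: Ash–Stevens 1986 / Stevens 1985 cuspidal-group generation; Lee–Sun 2019 §3 needs `ρ̄` irreducible, `p ∤ 2N`).  Typed VERBATIM from HOME/es/Sketch-es-g18.lean ef55fface19232db §4 (typer g13, T-es-22); REF1 §R67: SURVIVES; nothing asserted.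
[conjecture — cell candidate, NOT a tree fact] -/
@[conjecture]
def ThreeAdicWitnessOfPlusIndexPrimeToThree : Prop :=
  ∀ (W : WeierstrassCurve ℚ) [W.IsElliptic] [W.IsGloballyMinimal] {N : ℕ} [NeZero N]
    (D : ModularParametrizationData W N),
    (∀ z ∈ D.L.lattice, ∃ w ∈ periodLattice D.f, z = D.c * w) → 3 ^ 2 ∣ N →
    PlusIndexPrimeTo 3 D.f → ThreeAdicPolarWitness W W D.f

/-- **E-es-66₂** (g18 LAW, the f-shadow of GEN⋆₂): the `2`-adic twin (allowed set: odd order, `χ(8) ≠ 1`).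
Evidence: E42 (GEN⋆₂ exact at 55 levels 4 ∣ N) + E27/E28 (LAW b1 = 0, 292/292).
Cell bsd-f2-manin row **E-es-66₂** — LAW (p = 2 twin). BC5: E42 v2 all 86 levels `4 ∣ N ≤ 360` exact; E27/E28 292/292.  Typed VERBATIM from HOME/es/Sketch-es-g18.lean ef55fface19232db §4 (typer g13, T-es-22); REF1 §R67: SURVIVES; nothing asserted.
[conjecture — cell candidate, NOT a tree fact] -/
@[conjecture]
def TwoAdicWitnessOfPlusIndexOdd : Prop :=
  ∀ (W : WeierstrassCurve ℚ) [W.IsElliptic] [W.IsGloballyMinimal] {N : ℕ} [NeZero N]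
    (D : ModularParametrizationData W N),
    (∀ z ∈ D.L.lattice, ∃ w ∈ periodLattice D.f, z = D.c * w) → 2 ^ 2 ∣ N →
    PlusIndexPrimeTo 2 D.f → TwoAdicPolarWitness W W D.f

/-- **E-es-67** (g18 index LAW at additive 3): for optimal `W` with `9 ∣ N` and no rational `3`-torsion the
plus index `[Λ_f⁺ : Λ₁(f)⁺]` is prime to `3`.  Evidence: E38 (κ1 = 0 on the locus, 54/54 of 56; the two
exceptions 27a1, 54a1 have rational 3-torsion) and the E42c proxy scan (all 10 082 classes with 9 ∣ N < 10⁴: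
`Ω(E⋆)/Ω(E₀)` is prime to 3 except 27a, 54a, granted `E₁ = E⋆` (Stevens) and `c₁ = 1`).
Cell bsd-f2-manin row **E-es-67** — LAW = E-es-67♮ ∧ E-es-67♯ (`plusIndexPrimeToThreeOfNoRationalThreeTorsion_of_halves`). BC5: E38 54/54 on the locus; E42c proxy scan 10 082 classes `9 ∣ N < 10⁴`, exceptions exactly 27a, 54a (rational 3-torsion).  Typed VERBATIM from HOME/es/Sketch-es-g18.lean ef55fface19232db §4 (typer g13, T-es-22); REF1 §R67: SURVIVES; nothing asserted.
[conjecture — cell candidate, NOT a tree fact] -/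
@[conjecture]
def PlusIndexPrimeToThreeOfNoRationalThreeTorsion : Prop :=
  ∀ (W : WeierstrassCurve ℚ) [W.IsElliptic] [W.IsGloballyMinimal] {N : ℕ} [NeZero N]
    (D : ModularParametrizationData W N),
    (∀ z ∈ D.L.lattice, ∃ w ∈ periodLattice D.f, z = D.c * w) → 3 ^ 2 ∣ N →
    (∀ X₀ Y₀ : ℚ, ¬ IsShortThreeTorsion W D.c X₀ Y₀) → PlusIndexPrimeTo 3 D.f

/-- `W ⊇ μ₃`: the short model `E_{W,c}` (`a₁ = a₂ = a₃ = 0`) has a `3`-division point with rational abscissa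
whose ordinate lies in `√(-3)·ℚˣ` — equivalently the subgroup it generates is Galois-isomorphic to `μ₃`, equivalently the
quadratic twist `W^{(-3)}` has a rational point of order `3`. -/
def HasShortMuThree (W : WeierstrassCurve ℚ) (c : ℤ) : Prop :=
  ∃ X₀ T₀ : ℚ, (shortModel W c).Ψ₃.IsRoot X₀ ∧ T₀ ≠ 0 ∧
    X₀ ^ 3 + (shortModel W c).a₄ * X₀ + (shortModel W c).a₆ = -3 * T₀ ^ 2

/-- **E-es-67♮** (g18; the PROVABLE core of E-es-67, in print modulo the analytic dictionary): if `W ⊉ μ₃` then the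
plus index `[Λ_f⁺ : Λ₁(f)⁺]` is prime to `3`.  Route: `[Λ_f : Λ₁(f)] = #V₀`, `V₀ = W ∩ Σ(N)` (Shimura subgroup, of
multiplicative type; the Shimura cover `ℂ/Λ₁(f) → ℂ/Λ_f` is `E₁ → E₀` with constant kernel `V₀ᴰ` — Vatsal 2005 Rem. 1.8,
Ling–Oesterlé), the plus index divides `#V₀`, and `3 ∣ #V₀ ⟹ μ₃ ⊆ V₀ ⊆ W`.  No `9 ∣ N` needed.
Cell bsd-f2-manin row **E-es-67♮** — THEOREM ON PAPER modulo the analytic dictionary (MEMO-es §31.12: `[Λ_f : Λ₁(f)] = #(W ∩ Σ(N))`, `Σ(N)` of μ-type — Ling–Oesterlé 1991, Vatsal 2005 Rem. 1.8); filed as an open tree obligation until formalized.  Typed VERBATIM from HOME/es/Sketch-es-g18.lean ef55fface19232db §4 (typer g13, T-es-22); REF1 §R67: THEOREM-candidate (degree argument VALID); nothing asserted.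
[conjecture — cell candidate, NOT a tree fact] -/
@[conjecture]
def PlusIndexPrimeToThreeOfNoMuThree : Prop :=
  ∀ (W : WeierstrassCurve ℚ) [W.IsElliptic] [W.IsGloballyMinimal] {N : ℕ} [NeZero N]
    (D : ModularParametrizationData W N),
    (∀ z ∈ D.L.lattice, ∃ w ∈ periodLattice D.f, z = D.c * w) →
    ¬ HasShortMuThree W D.c → PlusIndexPrimeTo 3 D.f

/-- **E-es-67♯** (g18; the EMPIRICAL remainder of E-es-67): at `9 ∣ N`, `μ₃ ⊆ W` without a rational `3`-torsion point
still has plus index prime to `3` (E42c: all 508 such classes with `9 ∣ N < 10⁴` have `A₃ = 0`; 373 of them sit at levels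
with `3 ∣ |G/I| = #Σ(N)`, where E-es-67♮'s argument is silent).  E-es-67 = E-es-67♮ ∧ E-es-67♯.
Cell bsd-f2-manin row **E-es-67♯** — LAW (the EMPIRICAL remainder of E-es-67). BC5: E42c 508/508 classes `9 ∣ N < 10⁴` with `μ₃ ⊆ W`, no rational 3-torsion: `A₃ = 0` (373 of them at levels with `3 ∣ #Σ(N)`).  Typed VERBATIM from HOME/es/Sketch-es-g18.lean ef55fface19232db §4 (typer g13, T-es-22); REF1 §R67: SURVIVES; nothing asserted.
[conjecture — cell candidate, NOT a tree fact] -/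
@[conjecture]
def PlusIndexPrimeToThreeOfMuThreeNoRationalThreeTorsion : Prop :=
  ∀ (W : WeierstrassCurve ℚ) [W.IsElliptic] [W.IsGloballyMinimal] {N : ℕ} [NeZero N]
    (D : ModularParametrizationData W N),
    (∀ z ∈ D.L.lattice, ∃ w ∈ periodLattice D.f, z = D.c * w) → 3 ^ 2 ∣ N →
    HasShortMuThree W D.c → (∀ X₀ Y₀ : ℚ, ¬ IsShortThreeTorsion W D.c X₀ Y₀) → PlusIndexPrimeTo 3 D.f

/-- E-es-67 from its two halves (PROVED, by cases on `μ₃ ⊆ W`). -/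
theorem plusIndexPrimeToThreeOfNoRationalThreeTorsion_of_halves
    (h : PlusIndexPrimeToThreeOfNoMuThree) (h' : PlusIndexPrimeToThreeOfMuThreeNoRationalThreeTorsion) :
    PlusIndexPrimeToThreeOfNoRationalThreeTorsion := by
  intro W _ _ N _ D hopt h9 hT
  by_cases hmu : HasShortMuThree W D.c
  · exact h' W D hopt h9 hmu hT
  · exact h W D hopt hmu

/-- **E-es-61 = E-es-66 ∘ E-es-67** (PROVED decomposition of the v9/v10 input `h61`). -/
theorem threeAdicUnitWitnessOfNoRationalThreeTorsion_of_plusIndex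
    (h66 : ThreeAdicWitnessOfPlusIndexPrimeToThree)
    (h67 : PlusIndexPrimeToThreeOfNoRationalThreeTorsion) :
    ThreeAdicUnitWitnessOfNoRationalThreeTorsion := by
  intro W _ _ N _ D hopt h9 hT
  exact h66 W D hopt h9 (h67 W D hopt h9 hT)

/-- Sanity: the plus-index predicate is monotone in the obvious way — index prime to `p` is implied by
equality of the two lattices (e.g. `|G/I| = 1`, as at `N = 36`). -/
theorem plusIndexPrimeTo_of_eq {p : ℕ} (hp : p.Prime) {N : ℕ} (f : CuspForm (Gamma0 N) 2)
    (h : periodLatticeGamma1 f = periodLattice f) : PlusIndexPrimeTo p f := by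
  intro x hx
  exact ⟨x, h ▸ hx, 1, by simpa using hp.one_lt.ne', by simp⟩


/-! ### §4c. THE HECKE SIEVE (g18 addendum): `PlusIndexPrimeTo p f` BY NAME from the tree's THEOREM W
(`heckeEigenPeriodCongruence_holds`: `(a − q)·Λ₀(f) ⊆ Λ₁(f)` for `T_q f = a f`, `q ∣ N` prime — Ling–Oesterlé).
Consequence: E-es-66's hypothesis is a THEOREM for every optimal class having a prime `q ∣ N`, `q ≠ p`, with
`q² ∣ N` or `p ∤ a_q − q` (8 897 of the 10 082 classes with `9 ∣ N < 10⁴`; 5 744 of 14 030 with `4 ∣ N`). -/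

/-- A natural multiplier prime to `p` pushing `Λ₀(f)` into `Λ₁(f)` makes the plus index prime to `p` (PROVED). -/
theorem plusIndexPrimeTo_of_natMul_mem {p k : ℕ} (hk : ¬ p ∣ k) {N : ℕ} (f : CuspForm (Gamma0 N) 2)
    (h : ∀ w ∈ periodLattice f, (k : ℂ) * w ∈ periodLatticeGamma1 f) : PlusIndexPrimeTo p f := by
  intro x hx
  refine ⟨(k : ℂ) * x, h x hx, k, hk, ?_⟩
  rw [map_mul, Complex.conj_natCast]; ring

/-- Integer-multiplier version (PROVED). -/
theorem plusIndexPrimeTo_of_intMul_mem {p : ℕ} {a : ℤ} (ha : ¬ (p : ℤ) ∣ a) {N : ℕ} (f : CuspForm (Gamma0 N) 2)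
    (h : ∀ w ∈ periodLattice f, (a : ℂ) * w ∈ periodLatticeGamma1 f) : PlusIndexPrimeTo p f := by
  obtain ⟨n, rfl | rfl⟩ := Int.eq_nat_or_neg a
  · refine plusIndexPrimeTo_of_natMul_mem (fun hd => ha (Int.natCast_dvd_natCast.mpr hd)) f fun w hw => ?_
    have := h w hw
    push_cast at this
    exact this
  · refine plusIndexPrimeTo_of_natMul_mem (fun hd => ha (dvd_neg.mpr (Int.natCast_dvd_natCast.mpr hd))) f
      fun w hw => ?_
    have := h w hw
    push_cast at this
    rw [neg_mul] at this
    exact neg_mem_iff.mp this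

/-- **THE HECKE SIEVE** (PROVED from the tree's THEOREM W `heckeEigenPeriodCongruence_holds`): a `T_q`-eigenvalue
`a ∈ ℤ` at a prime `q ∣ N` with `p ∤ a − q` makes the plus index (indeed the whole Shimura quotient) prime to `p`. -/
theorem plusIndexPrimeTo_of_heckeT_eigen {N : ℕ} [NeZero N] (f : CuspForm (Gamma0 N) 2) {q : ℕ} [NeZero q]
    (hq : q.Prime) (hqN : q ∣ N) {a : ℤ} (hT : heckeT (Gamma0 N) 2 q f = (a : ℂ) • f) {p : ℕ}
    (hpa : ¬ (p : ℤ) ∣ a - q) : PlusIndexPrimeTo p f := by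
  refine plusIndexPrimeTo_of_intMul_mem hpa f fun w hw => ?_
  have h := heckeEigenPeriodCongruence_holds N q f (a : ℂ) hq hqN hT w hw
  push_cast
  exact h

/-- **Traceless corollary** (PROVED from the tree's `pMulLatticeLeGamma1OfTracelessPrime_holds`): a newform with a
second additive prime `q` (`q² ∣ N`, `p ∤ q`) has plus index prime to `p`. -/
theorem plusIndexPrimeTo_of_sq_dvd {N : ℕ} [NeZero N] {f : CuspForm (Gamma0 N) 2} (hf : IsNewform0 f) {q : ℕ}
    (hq : q.Prime) (hqN : q ^ 2 ∣ N) {p : ℕ} (hpq : ¬ p ∣ q) : PlusIndexPrimeTo p f :=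
  plusIndexPrimeTo_of_natMul_mem hpq f fun w hw =>
    pMulLatticeLeGamma1OfTracelessPrime_holds N f hf q hq ((dvd_pow_self q two_ne_zero).trans hqN)
      (hf.cuspCoeff_eq_zero_of_sq_dvd hq hqN) w hw

/-- For a modular parametrisation: a second additive prime `q ≠ 3` discharges E-es-66's hypothesis (PROVED). -/
theorem plusIndexPrimeTo_three_of_sq_dvd {W : WeierstrassCurve ℚ} {N : ℕ} [NeZero N]
    (D : ModularParametrizationData W N) {q : ℕ} (hq : q.Prime) (hq3 : q ≠ 3) (hqN : q ^ 2 ∣ N) :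
    PlusIndexPrimeTo 3 D.f :=
  plusIndexPrimeTo_of_sq_dvd D.isNewformOf.1 hq hqN fun h =>
    hq3 ((Nat.prime_dvd_prime_iff_eq Nat.prime_three hq).mp h).symm

/-- For a modular parametrisation: a multiplicative prime `q ∥ N` with `3 ∤ a_q − q` discharges E-es-66's
hypothesis (PROVED; `a_q = cuspCoeff D.f q` supplied as an integer). -/
theorem plusIndexPrimeTo_of_cuspCoeff {W : WeierstrassCurve ℚ} {N : ℕ} [NeZero N]
    (D : ModularParametrizationData W N) {q : ℕ} [NeZero q] (hq : q.Prime) (hqN : q ∣ N) {a : ℤ}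
    (ha : cuspCoeff D.f q = (a : ℂ)) {p : ℕ} (hpa : ¬ (p : ℤ) ∣ a - q) : PlusIndexPrimeTo p D.f :=
  plusIndexPrimeTo_of_heckeT_eigen D.f hq hqN
    (by rw [D.isNewformOf.1.heckeT_eq_coeff_smul hq]; exact congrArg (· • D.f) ha) hpa

/-- **E-es-66 UNCONDITIONAL ON THE SIEVED FAMILY** (PROVED edge): with a second additive prime `q ≠ 3`, E-es-66 alone
yields the `3`-adic polar witness. -/
theorem threeAdicPolarWitness_of_e66_of_sq_dvd (h66 : ThreeAdicWitnessOfPlusIndexPrimeToThree)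
    (W : WeierstrassCurve ℚ) [W.IsElliptic] [W.IsGloballyMinimal] {N : ℕ} [NeZero N]
    (D : ModularParametrizationData W N) (hopt : ∀ z ∈ D.L.lattice, ∃ w ∈ periodLattice D.f, z = D.c * w)
    (h9 : 3 ^ 2 ∣ N) {q : ℕ} (hq : q.Prime) (hq3 : q ≠ 3) (hqN : q ^ 2 ∣ N) :
    ThreeAdicPolarWitness W W D.f :=
  h66 W D hopt h9 (plusIndexPrimeTo_three_of_sq_dvd D hq hq3 hqN)


/-! ### §4d. BY-NAME EDGES FROM THE TREE'S 3-ADIC Γ₀/Γ₁ TRICHOTOMY (p3 g6, `trichotomy_shimura_of_nine_dvd_level`). -/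

/-- **At `N = 9p`, `p ≡ 2 (mod 3)`, no rational `3`-isogeny ⟹ E-es-66's hypothesis** (PROVED edge, from the tree's
`stevens_eq_optimal_of_noRationalThreeIsogeny_nine_mul_prime`: there `Λ₁(f) = Λ₀(f)`). -/
theorem plusIndexPrimeTo_three_of_noRationalThreeIsogeny_nine_mul_prime {W₁ W₀ : WeierstrassCurve ℚ}
    [W₁.IsElliptic] [W₁.IsGloballyMinimal] [W₀.IsElliptic] [W₀.IsGloballyMinimal] {p : ℕ} (hp : p.Prime) (hp3 : p % 3 = 2) [NeZero (9 * p)]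
    (D₁ : Gamma1ParametrizationData W₁ (9 * p)) (D₀ : ModularParametrizationData W₀ (9 * p))
    (hiso : IsIsogenous W₁ W₀) (h₁ : D₁.IsOptimal)
    (h₀ : ∀ z ∈ D₀.L.lattice, ∃ w ∈ periodLattice D₀.f, z = D₀.c * w) (hno : ∀ x : ℚ, W₀.Ψ₃.eval x ≠ 0) :
    PlusIndexPrimeTo 3 D₀.f :=
  plusIndexPrimeTo_of_eq Nat.prime_three D₀.f
    (Summit.BirchSwinnertonDyer.BirchSwinnertonDyer.Theorems.ManinLocalTwoThree.stevens_eq_optimal_of_noRationalThreeIsogeny_nine_mul_prime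
      hp hp3 D₁ D₀ hiso h₁ h₀ hno).1

/-- **General `9 ∣ N`, no rational `3`-isogeny, Shimura quotient not `W[3]` ⟹ E-es-66's hypothesis** (PROVED edge from
the tree's `trichotomy_shimura_of_nine_dvd_level`; the excluded middle case `Λ₁(f) = 3Λ₀(f)` would make `W₀ ∩ Σ(N) =
W₀[3]`, impossible once `Σ(N)` is known to be of multiplicative type — not yet a tree fact). -/
theorem plusIndexPrimeTo_three_of_noRationalThreeIsogeny_of_ne_three_mul {W₁ W₀ : WeierstrassCurve ℚ}
    [W₁.IsElliptic] [W₁.IsGloballyMinimal] [W₀.IsElliptic] [W₀.IsGloballyMinimal] {N : ℕ} [NeZero N]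
    (D₁ : Gamma1ParametrizationData W₁ N) (D₀ : ModularParametrizationData W₀ N)
    (hiso : IsIsogenous W₁ W₀) (h₁ : D₁.IsOptimal)
    (h₀ : ∀ z ∈ D₀.L.lattice, ∃ w ∈ periodLattice D₀.f, z = D₀.c * w) (h9 : 3 ^ 2 ∣ N)
    (hno : ∀ x : ℚ, W₀.Ψ₃.eval x ≠ 0)
    (h9Λ : ¬ ∀ z : ℂ, z ∈ periodLatticeGamma1 D₀.f ↔ ∃ w ∈ periodLattice D₀.f, z = 3 * w) :
    PlusIndexPrimeTo 3 D₀.f := by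
  rcases Summit.BirchSwinnertonDyer.BirchSwinnertonDyer.Theorems.ManinLocalTwoThree.trichotomy_shimura_of_nine_dvd_level D₁ D₀ hiso h₁ h₀ h9 with h | h | ⟨x, hx⟩
  · exact plusIndexPrimeTo_of_eq Nat.prime_three D₀.f h
  · exact absurd h h9Λ
  · exact absurd hx (hno x)

end Summit.BirchSwinnertonDyer.Rank1Residual.ManinAdditive.KatoCurve

end
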